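import Mathlib
import HarnessLib

/-!
# Crux `BirComplexStableXYR` (stmt-HubbardSuperconductivity-14845): the exact smoothed-box
# partition of unity `Σ_{n ∈ ℤ} χ_v(s - 2πn) = 1`

Support file (prover seat 0, route BalabanIR) for the restated engine
`…Theses.BalabanIR.BirComplexStableXYR`: the checkable statement `SmoothedBoxPartition` shared by the
idea cards `Cruxes/BirComplexStableXYR/Ideas/log-concave-core-bounded-phase.md` and
`…/real-covariance-multiscale-port.md` (the exact smoothed-box lift of the torus integral to `ℝ^Λ`).
With the Gaussian-smoothed box `χ_v(s) := ∫_{[-π,π]} g_v(s - t) dt` (`g_v` = Mathlib's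
`gaussianPDFReal 0 v`, variance `v ≠ 0`):

* `smoothedBox_hasSum` — `HasSum (n ↦ χ_v(s - 2πn)) 1` for every `s` (the period cells
  `(s - 2πn - π, s - 2πn + π]` tile `ℝ`, `Set.pairwise_disjoint_Ioc_add_zsmul` / `iUnion_Ioc_add_zsmul`,
  and `∫ g_v = 1`);
* `smoothedBox_nonneg`, `smoothedBox_le_one` — `0 ≤ χ_v ≤ 1`.

The selector is written inline (no new definition). [folklore]
-/

noncomputable section

namespace Summit.HubbardSuperconductivity.HubbardSuperconductivity.Theorems

open MeasureTheory

section SmoothedBoxPartition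

/-- A smoothed box evaluated at `s - 2πn` is the integral of the Gaussian over the period cell
`(s - 2πn - π, s - 2πn + π]`. [folklore] -/
theorem smoothedBox_eq_setIntegral_cell (v : NNReal) (s : ℝ) (n : ℤ) :
    (∫ t in Set.Icc (-Real.pi) Real.pi,
        ProbabilityTheory.gaussianPDFReal 0 v (s - 2 * Real.pi * n - t)) =
      ∫ u in Set.Ioc (s - 2 * Real.pi * n - Real.pi) (s - 2 * Real.pi * n + Real.pi),
        ProbabilityTheory.gaussianPDFReal 0 v u := by
  have hπ := Real.pi_pos
  rw [integral_Icc_eq_integral_Ioc, ← intervalIntegral.integral_of_le (by linarith),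
    ← intervalIntegral.integral_of_le (by linarith)]
  rw [intervalIntegral.integral_comp_sub_left (fun u => ProbabilityTheory.gaussianPDFReal 0 v u)
    (s - 2 * Real.pi * n)]
  congr 1
  ring

/-- **Smoothed-box partition of unity.**  For every variance `v ≠ 0` and every `s : ℝ`,
`Σ_{n ∈ ℤ} ∫_{[-π,π]} g_v(s - 2πn - t) dt = 1` as a `HasSum`. [folklore] -/
theorem smoothedBox_hasSum (v : NNReal) (hv : v ≠ 0) (s : ℝ) :
    HasSum (fun n : ℤ => ∫ t in Set.Icc (-Real.pi) Real.pi,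
      ProbabilityTheory.gaussianPDFReal 0 v (s - 2 * Real.pi * n - t)) 1 := by
  set g : ℝ → ℝ := ProbabilityTheory.gaussianPDFReal 0 v with hg
  have hgi : Integrable g := ProbabilityTheory.integrable_gaussianPDFReal 0 v
  -- the period cells tile `ℝ`
  have key := hasSum_integral_iUnion (μ := volume) (f := g)
    (s := fun m : ℤ => Set.Ioc (s - Real.pi + m • (2 * Real.pi)) (s - Real.pi + (m + 1) • (2 * Real.pi)))
    (fun m => measurableSet_Ioc) (Set.pairwise_disjoint_Ioc_add_zsmul (s - Real.pi) (2 * Real.pi))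
    hgi.integrableOn
  rw [iUnion_Ioc_add_zsmul (by positivity : (0:ℝ) < 2 * Real.pi) (s - Real.pi), setIntegral_univ,
    hg, ProbabilityTheory.integral_gaussianPDFReal_eq_one 0 hv] at key
  -- reindex `m = -n`
  have hF : (fun n : ℤ => ∫ t in Set.Icc (-Real.pi) Real.pi,
      ProbabilityTheory.gaussianPDFReal 0 v (s - 2 * Real.pi * n - t)) =
      (fun m : ℤ => ∫ u in Set.Ioc (s - Real.pi + m • (2 * Real.pi))
        (s - Real.pi + (m + 1) • (2 * Real.pi)), ProbabilityTheory.gaussianPDFReal 0 v u) ∘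
        (Equiv.neg ℤ) := by
    funext n
    simp only [Function.comp_apply, Equiv.neg_apply]
    rw [smoothedBox_eq_setIntegral_cell]
    have e1 : s - Real.pi + (-n) • (2 * Real.pi) = s - 2 * Real.pi * n - Real.pi := by
      rw [zsmul_eq_mul]; push_cast; ring
    have e2 : s - Real.pi + (-n + 1) • (2 * Real.pi) = s - 2 * Real.pi * n + Real.pi := by
      rw [zsmul_eq_mul]; push_cast; ring
    rw [e1, e2]
  rw [hF, Equiv.hasSum_iff]
  exact key

/-- The smoothed box is non-negative. [folklore] -/
theorem smoothedBox_nonneg (v : NNReal) (s : ℝ) (n : ℤ) :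
    0 ≤ ∫ t in Set.Icc (-Real.pi) Real.pi,
        ProbabilityTheory.gaussianPDFReal 0 v (s - 2 * Real.pi * n - t) :=
  integral_nonneg fun _ => ProbabilityTheory.gaussianPDFReal_nonneg 0 v _

/-- The smoothed box is at most `1` (for `v ≠ 0`). [folklore] -/
theorem smoothedBox_le_one (v : NNReal) (hv : v ≠ 0) (s : ℝ) (n : ℤ) :
    (∫ t in Set.Icc (-Real.pi) Real.pi,
        ProbabilityTheory.gaussianPDFReal 0 v (s - 2 * Real.pi * n - t)) ≤ 1 := by
  rw [smoothedBox_eq_setIntegral_cell, ← ProbabilityTheory.integral_gaussianPDFReal_eq_one 0 hv]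
  exact setIntegral_le_integral (ProbabilityTheory.integrable_gaussianPDFReal 0 v)
    (Filter.Eventually.of_forall fun _ => ProbabilityTheory.gaussianPDFReal_nonneg 0 v _)

end SmoothedBoxPartition

end Summit.HubbardSuperconductivity.HubbardSuperconductivity.Theorems
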